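/-
Copyright (c) 2026 the pub-hodgecm-mathlib formalisation cell (harness21).  Prover seat hodgecm-mathlib-B-p14 (g30), (F11) LAYER B′ FILE 3 (ii-b): the valuation regimes
of Prop. 16's two congruences (DESIGN v3 §FILE 3; architect A-p06 (g26)), 2026-09-01.
-/
import Literature.NumberTheory.Automorphic.UnitaryThreeAnisotropicConjugationEntries   -- ★ p841676 (this seat): `conj_model_entry00_sub_one_of_unitarity`; brings ★ Bounds
import HarnessLib

/-!
# Flicker's Proposition 16, step (ii-b): the valuations of the two fixed-point expressions — condition 1 is `m ≤ N` for every coset; in the regime `2m ≤ N`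
# condition 2 is `|A_t − 1| ≤ |ϖ|^{2m+1}` for every coset (Flicker 1998, Prop. 16 p. 96: «`0 ≤ m ≤ [N∕2]` … for all `c`»)

Topic `NumberTheory/Automorphic`; namespace `Literature.NumberTheory.Automorphic.UnitaryGroup`.  THEOREMS ONLY; valuation algebra over the ★ `LocalConjDatum` frame
(no matrices).  Cell `pub/hodgecm-mathlib`, crux H413, line «N7nsCount», value stub `stub_irredGValueNeg` (κ = −1), LAYER B′.  The two expressions of ★ FILE 3 (ii-a)
`fixedPoint_mem_unitaryInt_iff` are, for `t` of type (2) with exponent `N` read in the anisotropic frame (★ Bounds ED. 2: `|q_t| = |r_t| = |ϖ|^N`,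
`|A_t − s_t| ≤ |ϖ|^{N+1}`) and any `h ∈ Stab(w₀)` (`|s| = 1`, `|q| ≤ 1`):
* `v_fixedPoint_expr01_eq`: **`|(A_t − s_t)·s·q + q_t·s² − 4ϖ·r_t·q²| = |ϖ|^N`** (the middle term dominates) ⇒ `fixedPoint_cond01_iff`: condition 1 ⟺ **`m ≤ N`**, for EVERY `h`;
* `fixedPoint_expr00_eq_det_mul`: expression 2 `= Δ_h · [(A_t − 1) − 4ϖ(A_t − s_t)(σq·q) − 4ϖ(X − Δ_tσX)]` (★ `conj_model_entry00_sub_one_of_unitarity` × `Δ_h`);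
* `v_add_le_iff_of_le_aniso`: ultrametric absorption `|y| ≤ B ⇒ (|x + y| ≤ B ↔ |x| ≤ B)`;
* **`fixedPoint_cond00_iff_of_two_mul_le`**: in the regime `2m ≤ N` the correction terms are `≤ |ϖ|^{2m+1}`, so condition 2 ⟺ **`|A_t − 1| ≤ |ϖ|^{2m+1}`** — again
  h-INDEPENDENT: every coset of `Stab(w₀) ⧸ H′_m` is `t`-fixed, or none is (Prop. 16's first row `(q+1)q^{4m}` = `#(Stab(w₀) ⧸ H′_m)`, resp. `0`).
The regime `[N∕2] < m ≤ N` (one σ-semilinear congruence on `σq mod ϖ^{2m−N}`, `q^N` of `q^{2m}` residues) is FILE 3 (iii).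
HONEST LABEL: HC_CM is proved only modulo the printed citations until rung 0 closes; valuation bookkeeping feeding ONE value stub of #103-ns.

## References
* [Flicker1998UnitaryFL] Y. Z. Flicker, *Elementary proof of the fundamental lemma for a unitary group*, Canad. J. Math. 50 (1998), Prop. 16 p. 96.
-/

set_option autoImplicit false

noncomputable section

open scoped WithZero

namespace Literature.NumberTheory.Automorphic

namespace UnitaryGroup

open Literature.NumberTheory.Automorphic.HermitianLattice

variable {K : Type*} [Field K] [Valued K ℤᵐ⁰] {ϖ : K} (σ : K →+* K)

/-! ## §1 Condition 1: the `q`-expression has valuation exactly `|ϖ|^N` -/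

/-- **`|(A_t − s_t)·s·q + q_t·s² − 4ϖ·r_t·q²| = |ϖ|^N`** for `|s| = 1`, `|q| ≤ 1`, `|q_t| = |r_t| = |ϖ|^N`, `|A_t − s_t| ≤ |ϖ|^{N+1}`: the middle term dominates
strictly. [cite: Flicker1998UnitaryFL, Prop. 16 p. 96] -/
theorem v_fixedPoint_expr01_eq (hd : LocalConjDatum σ ϖ) {At st qt rt s q : K} (hs : Valued.v s = 1) (hq : Valued.v q ≤ 1) (N : ℕ)
    (hqt : Valued.v qt = WithZero.exp (-(N : ℤ))) (hrt : Valued.v rt = WithZero.exp (-(N : ℤ)))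
    (hAst : Valued.v (At - st) ≤ WithZero.exp (-((N : ℤ) + 1))) :
    Valued.v ((At - st) * s * q + qt * s ^ 2 - 4 * ϖ * rt * q ^ 2) = WithZero.exp (-(N : ℤ)) := by
  have h4 : Valued.v (4 : K) = 1 := by rw [show (4 : K) = 2 * 2 by norm_num, map_mul, hd.v2, one_mul]
  have hmain : Valued.v (qt * s ^ 2) = WithZero.exp (-(N : ℤ)) := by rw [map_mul, map_pow, hs, one_pow, mul_one, hqt]
  have hrest : Valued.v ((At - st) * s * q - 4 * ϖ * rt * q ^ 2) < WithZero.exp (-(N : ℤ)) := by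
    have hB : WithZero.exp (-((N : ℤ) + 1)) < WithZero.exp (-(N : ℤ)) := by rw [WithZero.exp_lt_exp]; omega
    refine lt_of_le_of_lt (Valuation.map_sub_le _ ?_ ?_) hB
    · rw [map_mul, map_mul, hs, mul_one]
      calc Valued.v (At - st) * Valued.v q ≤ WithZero.exp (-((N : ℤ) + 1)) * 1 := mul_le_mul' hAst hq
        _ = _ := mul_one _
    · rw [map_mul, map_mul, map_mul, h4, one_mul, hd.vϖ, hrt, map_pow, ← WithZero.exp_add]
      calc WithZero.exp (-1 + -(N : ℤ)) * Valued.v q ^ 2 ≤ WithZero.exp (-1 + -(N : ℤ)) * 1 :=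
            mul_le_mul' le_rfl (pow_le_one' hq 2)
        _ = WithZero.exp (-((N : ℤ) + 1)) := by rw [mul_one]; congr 1; ring
  have hre : (At - st) * s * q + qt * s ^ 2 - 4 * ϖ * rt * q ^ 2 = qt * s ^ 2 + ((At - st) * s * q - 4 * ϖ * rt * q ^ 2) := by ring
  rw [hre, Valuation.map_add_eq_of_lt_left _ (hmain ▸ hrest), hmain]

/-- **Condition 1 of the fixed-point criterion ⟺ `m ≤ N`**, for every `h`. [cite: Flicker1998UnitaryFL, Prop. 16 p. 96 («which means `0 ≤ m ≤ N`»)] -/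
theorem fixedPoint_cond01_iff (hd : LocalConjDatum σ ϖ) {At st qt rt s q : K} (hs : Valued.v s = 1) (hq : Valued.v q ≤ 1) (N m : ℕ)
    (hqt : Valued.v qt = WithZero.exp (-(N : ℤ))) (hrt : Valued.v rt = WithZero.exp (-(N : ℤ)))
    (hAst : Valued.v (At - st) ≤ WithZero.exp (-((N : ℤ) + 1))) :
    Valued.v ((At - st) * s * q + qt * s ^ 2 - 4 * ϖ * rt * q ^ 2) ≤ Valued.v (ϖ ^ m) ↔ m ≤ N := by
  rw [v_fixedPoint_expr01_eq σ hd hs hq N hqt hrt hAst, hd.v_pow, WithZero.exp_le_exp]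
  omega

/-! ## §2 Condition 2: the `A`-expression, and the regime `2m ≤ N` -/

omit [Valued K ℤᵐ⁰] in
/-- Expression 2 of ★ `fixedPoint_mem_unitaryInt_iff` equals `Δ_h` times the bracket of ★ `conj_model_entry00_sub_one_of_unitarity`:
`s(A_tA + q_tρ) − q(ρ_tA + s_tρ) − Δ_h = Δ_h·[(A_t − 1) − 4ϖ(A_t − s_t)(σq·q) − 4ϖ(q_tσq s − (A_t∕σs_t)(σq_t q σs))]`. [cite: Flicker1998UnitaryFL, Prop. 16 p. 96] -/
theorem fixedPoint_expr00_eq_det_mul (ϖ : K) {A q ρ s At qt ρt st : K} (hA : A ≠ 0) (hs : σ s ≠ 0) (hst : σ st ≠ 0)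
    (hΔ : A * s - ρ * q = A / σ s) (hρ : ρ = -(4 * ϖ * A * σ q) / σ s) (hρt : ρt = -(4 * ϖ * At * σ qt) / σ st)
    (hU2 : σ s * s + 4 * ϖ * (σ q * q) = 1) :
    s * (At * A + qt * ρ) - q * (ρt * A + st * ρ) - (A * s - ρ * q) =
      (A * s - ρ * q) * ((At - 1) - 4 * ϖ * (At - st) * (σ q * q) - 4 * ϖ * (qt * σ q * s - At / σ st * (σ qt * q * σ s))) := by
  have hΔ0 : A * s - ρ * q ≠ 0 := by rw [hΔ]; exact div_ne_zero hA hs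
  have key := conj_model_entry00_sub_one_of_unitarity σ ϖ hA hs hst hΔ hρ hρt hU2
  rw [← key, mul_sub, mul_one, ← mul_assoc, mul_inv_cancel₀ hΔ0, one_mul]

/-- Ultrametric absorption: `|y| ≤ B ⇒ (|x + y| ≤ B ↔ |x| ≤ B)`. [folklore] -/
private theorem v_add_le_iff_of_le_aniso {x y : K} {B : ℤᵐ⁰} (hy : Valued.v y ≤ B) : Valued.v (x + y) ≤ B ↔ Valued.v x ≤ B := by
  constructor
  · intro h
    have : x = (x + y) + (-y) := by ring
    rw [this]
    exact Valuation.map_add_le _ h (by rwa [Valuation.map_neg])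
  · intro h; exact Valuation.map_add_le _ h hy

/-- **Condition 2 in the regime `2m ≤ N` ⟺ `|A_t − 1| ≤ |ϖ|^{2m+1}`** (h-independent): the two correction terms `4ϖ(A_t − s_t)(σq·q)` and `4ϖ(X − Δ_tσX)` have valuation
`≤ |ϖ|^{N+1} ≤ |ϖ|^{2m+1}`.  Hypotheses: `|q| ≤ 1`, `|s| = 1`, `|q_t| = |ϖ|^N`, `|A_t − s_t| ≤ |ϖ|^{N+1}`, `|A_t| = |s_t| = 1`.
[cite: Flicker1998UnitaryFL, Prop. 16 p. 96 (first row: `0 ≤ m ≤ min([N∕2],[N₂∕2])`)] -/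
theorem fixedPoint_cond00_iff_of_two_mul_le (hd : LocalConjDatum σ ϖ) {At st qt s q : K} (hs : Valued.v s = 1) (hq : Valued.v q ≤ 1)
    (hAt : Valued.v At = 1) (hst1 : Valued.v st = 1) (N m : ℕ) (hmN : 2 * m ≤ N)
    (hqt : Valued.v qt = WithZero.exp (-(N : ℤ))) (hAst : Valued.v (At - st) ≤ WithZero.exp (-((N : ℤ) + 1))) :
    Valued.v ((At - 1) - 4 * ϖ * (At - st) * (σ q * q) - 4 * ϖ * (qt * σ q * s - At / σ st * (σ qt * q * σ s))) ≤ Valued.v (ϖ ^ (2 * m + 1)) ↔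
      Valued.v (At - 1) ≤ Valued.v (ϖ ^ (2 * m + 1)) := by
  have hvσ := hd.vσ
  have h4 : Valued.v (4 : K) = 1 := by rw [show (4 : K) = 2 * 2 by norm_num, map_mul, hd.v2, one_mul]
  have hB : WithZero.exp (-((N : ℤ) + 1)) ≤ Valued.v (ϖ ^ (2 * m + 1)) := by
    rw [hd.v_pow, WithZero.exp_le_exp]; push_cast; omega
  have hσq : Valued.v (σ q) ≤ 1 := by rw [hvσ]; exact hq
  -- the two correction terms are `≤ |ϖ|^{N+1}`
  have h1 : Valued.v (4 * ϖ * (At - st) * (σ q * q)) ≤ Valued.v (ϖ ^ (2 * m + 1)) := by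
    refine le_trans ?_ hB
    rw [map_mul, map_mul, map_mul, map_mul, h4, one_mul, hd.vϖ]
    calc WithZero.exp (-1 : ℤ) * Valued.v (At - st) * (Valued.v (σ q) * Valued.v q)
        ≤ 1 * WithZero.exp (-((N : ℤ) + 1)) * (1 * 1) := by
          refine mul_le_mul' (mul_le_mul' ?_ hAst) (mul_le_mul' hσq hq)
          rw [← WithZero.exp_zero, WithZero.exp_le_exp]; norm_num
      _ = WithZero.exp (-((N : ℤ) + 1)) := by rw [one_mul, mul_one, mul_one]
  have h2 : Valued.v (4 * ϖ * (qt * σ q * s - At / σ st * (σ qt * q * σ s))) ≤ Valued.v (ϖ ^ (2 * m + 1)) := by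
    refine le_trans ?_ hB
    rw [map_mul, map_mul, h4, one_mul, hd.vϖ, show -((N : ℤ) + 1) = -1 + -(N : ℤ) by ring, WithZero.exp_add]
    refine mul_le_mul' le_rfl (Valuation.map_sub_le _ ?_ ?_)
    · rw [map_mul, map_mul, hqt, hs, mul_one]
      calc WithZero.exp (-(N : ℤ)) * Valued.v (σ q) ≤ WithZero.exp (-(N : ℤ)) * 1 := mul_le_mul' le_rfl hσq
        _ = _ := mul_one _
    · rw [map_mul, map_div₀, hAt, hvσ, hst1, div_one, one_mul, map_mul, map_mul, hvσ, hqt, hvσ, hs, mul_one]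
      calc WithZero.exp (-(N : ℤ)) * Valued.v q ≤ WithZero.exp (-(N : ℤ)) * 1 := mul_le_mul' le_rfl hq
        _ = _ := mul_one _
  have hre : (At - 1) - 4 * ϖ * (At - st) * (σ q * q) - 4 * ϖ * (qt * σ q * s - At / σ st * (σ qt * q * σ s)) =
      (At - 1) + (-(4 * ϖ * (At - st) * (σ q * q)) + -(4 * ϖ * (qt * σ q * s - At / σ st * (σ qt * q * σ s)))) := by ring
  rw [hre, v_add_le_iff_of_le_aniso]
  exact Valuation.map_add_le _ (by rwa [Valuation.map_neg]) (by rwa [Valuation.map_neg])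

end UnitaryGroup

end Literature.NumberTheory.Automorphic

end
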